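import Summits.FinalStateConjecture.FinalStateConjecture.Theses.ClusterCompleteness
import Literature.Geometry.Lorentzian.CoordCurvature

/-! # Birth skeleton (BC3) for `ClusterCompleteness.TameEraRecurs` (child 2 of the split of `OmegaLimitMultiKerr`) — see Lines/birth.md -/

set_option linter.dupNamespace false

noncomputable section

open scoped Manifold ContDiff Topology ENNReal
open Set Filter Function TopologicalSpace

namespace Summit.FinalStateConjecture.FinalStateConjecture.Cruxes.TameEraRecurs.Birth

open Literature.Geometry.Lorentzian

/-! ### The piece (child 2 of the split of `ClusterCompleteness.OmegaLimitMultiKerr`), verbatim -/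

/-- `Sig.TameEraRecurs` — VERBATIM the statement of the route item `ClusterCompleteness.TameEraRecurs`
(child 2 of the BC2 redirect of `OmegaLimitMultiKerr`): every maximal development of admissible data
carrying a TAME ERA (closed-label chart system C2–C11 of the crux's interface, `C⁰` anchor `1/8`,
all-time `C^{k+4}` bounds, far-field quarantine) that does not settle (T2) RECURS at order `k + 2`
with CLOSED labels `|aᵢ| ≤ Mᵢ` (the crux's recur-disjunct C2–C13 verbatim, labels closed). -/
def Sig.TameEraRecurs : Prop :=
  open Literature.Geometry.Lorentzian in open scoped ContDiff in ∀ (k : ℕ) (X : Type) [TopologicalSpace X] [ChartedSpace E3 X] [IsManifold (𝓡 3) ∞ X] [T2Space X] [SecondCountableTopology X] [ConnectedSpace X], ∀ D ∈ admissibleVacuumData X, ∀ 𝒟 : VacuumCauchyDevelopment D, 𝒟.IsMaximal → (∃ (O : Set 𝒟.carrier) (N : ℕ) (M a : Fin N → ℝ) (mo : Fin N → lorentzGroup × E4) (τ₀ : ℝ) (Ψ : ∀ i, boostedKerrExterior (mo i).1 (mo i).2 (M i) (a i) → 𝒟.carrier) (ρ R : Fin N → ℝ → ℝ) (U₀ :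 Opens E4) (Ψ₀ : U₀ → 𝒟.carrier), (∀ i, 0 < M i ∧ |a i| ≤ M i) ∧ (∀ i, 𝒟.toSpacetime.IsLateChart (boostedKerrBackground (mo i).1 (mo i).2 (M i) (a i)) O τ₀ (Ψ i)) ∧ 𝒟.toSpacetime.IsLateChart (Minkowski.backgroundOn U₀) O τ₀ Ψ₀ ∧ (∀ i, Tendsto (fun t ↦ ρ i t / t) atTop (𝓝 0)) ∧ (∀ i, Tendsto (R i) atTop atTop ∧ ∀ τ, max (Kerr.rPlus (M i) (a i)) 0 + 1 ≤ R i τ) ∧ {x : E4 | τ₀ < x 0 ∧ ∀ i, ρ i (x 0) < Kerr.radius (a i) (poincareInv (mo i).1 (mo i).2 x)} ⊆ (U₀ : Set E4) ∧ (∀ R' : ℝ, ∃ τ₁ : ℝ, Pairwise (Function.onFun Disjoint fun i ↦ Ψ i '' (boostedKerrBackground (mo i).1 (mo i).2 (M i) (a i)).truncLateRegion τ₁ R')) ∧ O = Summit.FinalStateConjecture.exteriorOf 𝒟.toCauchyDevelopment ((⋃ i, Ψ i '' (boostedKerrBackground (mo i).1 (mo i).2 (M i) (a i)).lateRegion τ₀)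 ∪ Ψ₀ '' (Minkowski.backgroundOn U₀).lateRegion τ₀) ∧ Summit.FinalStateConjecture.RaysStayInClosure 𝒟.toCauchyDevelopment O ∧ (∀ τ₁ : ℝ, τ₀ < τ₁ → O \ (Ψ₀ '' (Minkowski.backgroundOn U₀).lateRegion τ₁ ∪ ⋃ i, Ψ i '' {x | τ₁ < (boostedKerrBackground (mo i).1 (mo i).2 (M i) (a i)).time x.1 ∧ (boostedKerrBackground (mo i).1 (mo i).2 (M i) (a i)).radius x.1 ≤ R i ((boostedKerrBackground (mo i).1 (mo i).2 (M i) (a i)).time x.1)}) ⊆ 𝒟.metric.causalPast 𝒟.timeOrientation (Ψ₀ '' (Minkowski.backgroundOn U₀).timeSlab τ₁ ∪ ⋃ i, Ψ i '' (boostedKerrBackground (mo i).1 (mo i).2 (M i) (a i)).truncTimeSlab (R i τ₁) τ₁)) ∧ ((∀ i, Summit.FinalStateConjecture.IsOrthochronous (mo i).1) ∧ ∀ τ : ℝ, τ₀ < τ → ∀ x ∈ (Minkowski.backgroundOn U₀).timeSlab τ, 𝒟.toSpacetime.timeOrientation.IsFutureDirected (mfderiv 𝓘(ℝ, E4) (𝓡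 4) Ψ₀ x (E4.basisVector 0))) ∧ (∀ τ : ℝ, τ₀ < τ → 𝒟.toSpacetime.deviationCk (Minkowski.backgroundOn U₀) Ψ₀ 0 τ ≤ ENNReal.ofReal (1 / 8) ∧ ∀ i, 𝒟.toSpacetime.truncDeviationCk (boostedKerrBackground (mo i).1 (mo i).2 (M i) (a i)) (Ψ i) 0 (R i τ) τ ≤ ENNReal.ofReal (1 / 8)) ∧ (∃ B : NNReal, ∀ τ : ℝ, τ₀ < τ → 𝒟.toSpacetime.deviationCk (Minkowski.backgroundOn U₀) Ψ₀ (k + 4) τ ≤ (B : ENNReal)) ∧ (∀ R' : ℝ, ∃ B : NNReal, ∀ τ : ℝ, τ₀ < τ → ∀ i, 𝒟.toSpacetime.truncDeviationCk (boostedKerrBackground (mo i).1 (mo i).2 (M i) (a i)) (Ψ i) (k + 4) R' τ ≤ (B : ENNReal)) ∧ (∀ ε : ℝ, 0 < ε → ∃ Rf : ℝ, ∀ τ : ℝ, τ₀ < τ → supCkENorm (Subtype.val '' {x | x ∈ (Minkowski.backgroundOn U₀).timeSlab τ ∧ Rf ≤ ‖E4.spatial (x : E4)‖}) (k + 4) (𝒟.toSpacetime.deviationExtend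 (Minkowski.backgroundOn U₀) Ψ₀) ≤ ENNReal.ofReal ε)) → ¬ (Summit.FinalStateConjecture.HasCompleteNullInfinity 𝒟.toCauchyDevelopment ∧ ∃ (O : Set 𝒟.carrier) (d : FinalStateDecomposition 𝒟.toSpacetime O 2), (∀ i, Kerr.IsSubextremal (d.mass i) (d.spin i)) ∧ O = Summit.FinalStateConjecture.exteriorOf 𝒟.toCauchyDevelopment d.charted ∧ Summit.FinalStateConjecture.RaysStayInClosure 𝒟.toCauchyDevelopment O ∧ Summit.FinalStateConjecture.HasExhaustiveCharts d ∧ Summit.FinalStateConjecture.IsFutureOriented d) → ∃ (O : Set 𝒟.carrier) (N : ℕ) (M a : Fin N → ℝ) (mo : Fin N → lorentzGroup × E4) (τ₀ : ℝ) (Ψ : ∀ i, boostedKerrExterior (mo i).1 (mo i).2 (M i) (a i) → 𝒟.carrier) (ρ R : Fin N → ℝ → ℝ) (U₀ : Opens E4) (Ψ₀ : U₀ → 𝒟.carrier), (∀ i, 0 < M i ∧ |a i| ≤ M i) ∧ (∀ i, 𝒟.toSpacetime.IsLateChart (boostedKerrBackground (mo i).1 (mo i).2 (M i) (a i)) O τ₀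 (Ψ i)) ∧ 𝒟.toSpacetime.IsLateChart (Minkowski.backgroundOn U₀) O τ₀ Ψ₀ ∧ (∀ i, Tendsto (fun t ↦ ρ i t / t) atTop (𝓝 0)) ∧ (∀ i, Tendsto (R i) atTop atTop ∧ ∀ τ, max (Kerr.rPlus (M i) (a i)) 0 + 1 ≤ R i τ) ∧ {x : E4 | τ₀ < x 0 ∧ ∀ i, ρ i (x 0) < Kerr.radius (a i) (poincareInv (mo i).1 (mo i).2 x)} ⊆ (U₀ : Set E4) ∧ (∀ R' : ℝ, ∃ τ₁ : ℝ, Pairwise (Function.onFun Disjoint fun i ↦ Ψ i '' (boostedKerrBackground (mo i).1 (mo i).2 (M i) (a i)).truncLateRegion τ₁ R')) ∧ O = Summit.FinalStateConjecture.exteriorOf 𝒟.toCauchyDevelopment ((⋃ i, Ψ i '' (boostedKerrBackground (mo i).1 (mo i).2 (M i) (a i)).lateRegion τ₀) ∪ Ψ₀ '' (Minkowski.backgroundOn U₀).lateRegion τ₀) ∧ Summit.FinalStateConjecture.RaysStayInClosure 𝒟.toCauchyDevelopment O ∧ (∀ τ₁ : ℝ, τ₀ < τ₁ → O \ (Ψ₀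 '' (Minkowski.backgroundOn U₀).lateRegion τ₁ ∪ ⋃ i, Ψ i '' {x | τ₁ < (boostedKerrBackground (mo i).1 (mo i).2 (M i) (a i)).time x.1 ∧ (boostedKerrBackground (mo i).1 (mo i).2 (M i) (a i)).radius x.1 ≤ R i ((boostedKerrBackground (mo i).1 (mo i).2 (M i) (a i)).time x.1)}) ⊆ 𝒟.metric.causalPast 𝒟.timeOrientation (Ψ₀ '' (Minkowski.backgroundOn U₀).timeSlab τ₁ ∪ ⋃ i, Ψ i '' (boostedKerrBackground (mo i).1 (mo i).2 (M i) (a i)).truncTimeSlab (R i τ₁) τ₁)) ∧ ((∀ i, Summit.FinalStateConjecture.IsOrthochronous (mo i).1) ∧ ∀ τ : ℝ, τ₀ < τ → ∀ x ∈ (Minkowski.backgroundOn U₀).timeSlab τ, 𝒟.toSpacetime.timeOrientation.IsFutureDirected (mfderiv 𝓘(ℝ, E4) (𝓡 4) Ψ₀ x (E4.basisVector 0))) ∧ (∀ τ : ℝ, τ₀ < τ → 𝒟.toSpacetime.deviationCk (Minkowski.backgroundOn U₀) Ψ₀ 0 τ ≤ ENNReal.ofReal (1 / 4) ∧ ∀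 i, 𝒟.toSpacetime.truncDeviationCk (boostedKerrBackground (mo i).1 (mo i).2 (M i) (a i)) (Ψ i) 0 (R i τ) τ ≤ ENNReal.ofReal (1 / 4)) ∧ ∀ R' : ℝ, ∀ ε : ℝ, 0 < ε → ∃ᶠ τ in atTop, 𝒟.toSpacetime.deviationCk (Minkowski.backgroundOn U₀) Ψ₀ (k + 2) τ ≤ ENNReal.ofReal ε ∧ ∀ i, 𝒟.toSpacetime.truncDeviationCk (boostedKerrBackground (mo i).1 (mo i).2 (M i) (a i)) (Ψ i) (k + 2) R' τ ≤ ENNReal.ofReal ε ∧ ∀ x ∈ (boostedKerrBackground (mo i).1 (mo i).2 (M i) (a i)).truncTimeSlab R' τ, 𝒟.toSpacetime.timeOrientation.IsFutureDirected (mfderiv 𝓘(ℝ, E4) (𝓡 4) (Ψ i) x (((mo i).1 : E4 ≃L[ℝ] E4) (Kerr.timeVector (M i) (a i) (poincareInv (mo i).1 (mo i).2 (x : E4)))))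

/-! ### Stub signatures (each also the statement of the registered `theorem stub_*` below) -/

/-- Signature of `stub_eraHorizonNull` (see the stub's docstring). -/
def Sig.stub_eraHorizonNull : Prop :=
  ∀ (k : ℕ) (X : Type) [TopologicalSpace X] [ChartedSpace E3 X] [IsManifold (𝓡 3) ∞ X] [T2Space X] [SecondCountableTopology X] [ConnectedSpace X], ∀ D ∈ admissibleVacuumData X, ∀ 𝒟 : VacuumCauchyDevelopment D, 𝒟.IsMaximal → ∀ (O : Set 𝒟.carrier) (N : ℕ) (M a : Fin N → ℝ) (mo : Fin N → lorentzGroup × E4) (τ₀ : ℝ) (Ψ : ∀ i, boostedKerrExterior (mo i).1 (mo i).2 (M i) (a i) → 𝒟.carrier) (ρ R : Fin N → ℝ → ℝ) (U₀ : Opens E4) (Ψ₀ : U₀ → 𝒟.carrier), (∀ i, 0 < M i ∧ |a i| ≤ M i) ∧ (∀ i, 𝒟.toSpacetime.IsLateChart (boostedKerrBackground (mo i).1 (mo i).2 (M i) (a i)) O τ₀ (Ψ i)) ∧ 𝒟.toSpacetime.IsLateChart (Minkowski.backgroundOn U₀) O τ₀ Ψ₀ ∧ (∀ i, Tendsto (fun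 t ↦ ρ i t / t) atTop (𝓝 0)) ∧ (∀ i, Tendsto (R i) atTop atTop ∧ ∀ τ, max (Kerr.rPlus (M i) (a i)) 0 + 1 ≤ R i τ) ∧ {x : E4 | τ₀ < x 0 ∧ ∀ i, ρ i (x 0) < Kerr.radius (a i) (poincareInv (mo i).1 (mo i).2 x)} ⊆ (U₀ : Set E4) ∧ (∀ R' : ℝ, ∃ τ₁ : ℝ, Pairwise (Function.onFun Disjoint fun i ↦ Ψ i '' (boostedKerrBackground (mo i).1 (mo i).2 (M i) (a i)).truncLateRegion τ₁ R')) ∧ O = Summit.FinalStateConjecture.exteriorOf 𝒟.toCauchyDevelopment ((⋃ i, Ψ i '' (boostedKerrBackground (mo i).1 (mo i).2 (M i) (a i)).lateRegion τ₀) ∪ Ψ₀ '' (Minkowski.backgroundOn U₀).lateRegion τ₀) ∧ Summit.FinalStateConjecture.RaysStayInClosure 𝒟.toCauchyDevelopment O ∧ (∀ τ₁ : ℝ, τ₀ < τ₁ → O \ (Ψ₀ '' (Minkowski.backgroundOn U₀).lateRegion τ₁ ∪ ⋃ i, Ψ i '' {x | τ₁ < (boostedKerrBackground (mo i).1 (mo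 i).2 (M i) (a i)).time x.1 ∧ (boostedKerrBackground (mo i).1 (mo i).2 (M i) (a i)).radius x.1 ≤ R i ((boostedKerrBackground (mo i).1 (mo i).2 (M i) (a i)).time x.1)}) ⊆ 𝒟.metric.causalPast 𝒟.timeOrientation (Ψ₀ '' (Minkowski.backgroundOn U₀).timeSlab τ₁ ∪ ⋃ i, Ψ i '' (boostedKerrBackground (mo i).1 (mo i).2 (M i) (a i)).truncTimeSlab (R i τ₁) τ₁)) ∧ ((∀ i, Summit.FinalStateConjecture.IsOrthochronous (mo i).1) ∧ ∀ τ : ℝ, τ₀ < τ → ∀ x ∈ (Minkowski.backgroundOn U₀).timeSlab τ, 𝒟.toSpacetime.timeOrientation.IsFutureDirected (mfderiv 𝓘(ℝ, E4) (𝓡 4) Ψ₀ x (E4.basisVector 0))) ∧ (∀ τ : ℝ, τ₀ < τ → 𝒟.toSpacetime.deviationCk (Minkowski.backgroundOn U₀) Ψ₀ 0 τ ≤ ENNReal.ofReal (1 / 8) ∧ ∀ i, 𝒟.toSpacetime.truncDeviationCk (boostedKerrBackground (mo i).1 (mo i).2 (M i) (a i)) (Ψ i) 0 (R i τ) τ ≤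 ENNReal.ofReal (1 / 8)) ∧ (∃ B : NNReal, ∀ τ : ℝ, τ₀ < τ → 𝒟.toSpacetime.deviationCk (Minkowski.backgroundOn U₀) Ψ₀ (k + 4) τ ≤ (B : ENNReal)) ∧ (∀ R' : ℝ, ∃ B : NNReal, ∀ τ : ℝ, τ₀ < τ → ∀ i, 𝒟.toSpacetime.truncDeviationCk (boostedKerrBackground (mo i).1 (mo i).2 (M i) (a i)) (Ψ i) (k + 4) R' τ ≤ (B : ENNReal)) ∧ (∀ ε : ℝ, 0 < ε → ∃ Rf : ℝ, ∀ τ : ℝ, τ₀ < τ → supCkENorm (Subtype.val '' {x | x ∈ (Minkowski.backgroundOn U₀).timeSlab τ ∧ Rf ≤ ‖E4.spatial (x : E4)‖}) (k + 4) (𝒟.toSpacetime.deviationExtend (Minkowski.backgroundOn U₀) Ψ₀) ≤ ENNReal.ofReal ε) → ∀ i, (∀ ε : ℝ, 0 < ε → ∃ δ : ℝ, 0 < δ ∧ ∀ τ : ℝ, τ₀ < τ → ∀ x ∈ (boostedKerrBackground (mo i).1 (mo i).2 (M i) (a i)).truncTimeSlab (Kerr.rPlus (M i) (a i) + δ) τ,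 |((fderiv ℝ (fun y ↦ Kerr.radius (a i) (poincareInv (mo i).1 (mo i).2 y)) (x : E4)) (MetricCoord.sharpAt (fun y ↦ (𝒟.toSpacetime.deviationExtend (boostedKerrBackground (mo i).1 (mo i).2 (M i) (a i)) (Ψ i)) y + boostedKerrBilin (mo i).1 (mo i).2 (M i) (a i) y) (x : E4) (fderiv ℝ (fun y ↦ Kerr.radius (a i) (poincareInv (mo i).1 (mo i).2 y)) (x : E4))))| ≤ ε)

/-- Signature of `stub_asymptoticallyStationaryEra` (see the stub's docstring). -/
def Sig.stub_asymptoticallyStationaryEra : Prop :=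
  ∀ (k : ℕ) (X : Type) [TopologicalSpace X] [ChartedSpace E3 X] [IsManifold (𝓡 3) ∞ X] [T2Space X] [SecondCountableTopology X] [ConnectedSpace X], ∀ D ∈ admissibleVacuumData X, ∀ 𝒟 : VacuumCauchyDevelopment D, 𝒟.IsMaximal → ¬ (Summit.FinalStateConjecture.HasCompleteNullInfinity 𝒟.toCauchyDevelopment ∧ ∃ (O : Set 𝒟.carrier) (d : FinalStateDecomposition 𝒟.toSpacetime O 2), (∀ i, Kerr.IsSubextremal (d.mass i) (d.spin i)) ∧ O = Summit.FinalStateConjecture.exteriorOf 𝒟.toCauchyDevelopment d.charted ∧ Summit.FinalStateConjecture.RaysStayInClosure 𝒟.toCauchyDevelopment O ∧ Summit.FinalStateConjecture.HasExhaustiveCharts d ∧ Summit.FinalStateConjecture.IsFutureOriented d) → ∀ (O : Set 𝒟.carrier) (N : ℕ) (M a : Fin N → ℝ) (mo : Fin N → lorentzGroup × E4) (τ₀ : ℝ) (Ψ : ∀ i, boostedKerrExterior (mo i).1 (mo i).2 (M i) (a i) → 𝒟.carrier) (ρ R : Fin N → ℝ → ℝ) (U₀ : Opens E4) (Ψ₀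 : U₀ → 𝒟.carrier), (∀ i, 0 < M i ∧ |a i| ≤ M i) ∧ (∀ i, 𝒟.toSpacetime.IsLateChart (boostedKerrBackground (mo i).1 (mo i).2 (M i) (a i)) O τ₀ (Ψ i)) ∧ 𝒟.toSpacetime.IsLateChart (Minkowski.backgroundOn U₀) O τ₀ Ψ₀ ∧ (∀ i, Tendsto (fun t ↦ ρ i t / t) atTop (𝓝 0)) ∧ (∀ i, Tendsto (R i) atTop atTop ∧ ∀ τ, max (Kerr.rPlus (M i) (a i)) 0 + 1 ≤ R i τ) ∧ {x : E4 | τ₀ < x 0 ∧ ∀ i, ρ i (x 0) < Kerr.radius (a i) (poincareInv (mo i).1 (mo i).2 x)} ⊆ (U₀ : Set E4) ∧ (∀ R' : ℝ, ∃ τ₁ : ℝ, Pairwise (Function.onFun Disjoint fun i ↦ Ψ i '' (boostedKerrBackground (mo i).1 (mo i).2 (M i) (a i)).truncLateRegion τ₁ R')) ∧ O = Summit.FinalStateConjecture.exteriorOf 𝒟.toCauchyDevelopment ((⋃ i, Ψ i '' (boostedKerrBackground (mo i).1 (mo i).2 (M i) (a i)).lateRegion τ₀) ∪ Ψ₀ ''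 (Minkowski.backgroundOn U₀).lateRegion τ₀) ∧ Summit.FinalStateConjecture.RaysStayInClosure 𝒟.toCauchyDevelopment O ∧ (∀ τ₁ : ℝ, τ₀ < τ₁ → O \ (Ψ₀ '' (Minkowski.backgroundOn U₀).lateRegion τ₁ ∪ ⋃ i, Ψ i '' {x | τ₁ < (boostedKerrBackground (mo i).1 (mo i).2 (M i) (a i)).time x.1 ∧ (boostedKerrBackground (mo i).1 (mo i).2 (M i) (a i)).radius x.1 ≤ R i ((boostedKerrBackground (mo i).1 (mo i).2 (M i) (a i)).time x.1)}) ⊆ 𝒟.metric.causalPast 𝒟.timeOrientation (Ψ₀ '' (Minkowski.backgroundOn U₀).timeSlab τ₁ ∪ ⋃ i, Ψ i '' (boostedKerrBackground (mo i).1 (mo i).2 (M i) (a i)).truncTimeSlab (R i τ₁) τ₁)) ∧ ((∀ i, Summit.FinalStateConjecture.IsOrthochronous (mo i).1) ∧ ∀ τ : ℝ, τ₀ < τ → ∀ x ∈ (Minkowski.backgroundOn U₀).timeSlab τ, 𝒟.toSpacetime.timeOrientation.IsFutureDirected (mfderiv 𝓘(ℝ, E4) (𝓡 4) Ψ₀ x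 (E4.basisVector 0))) ∧ (∀ τ : ℝ, τ₀ < τ → 𝒟.toSpacetime.deviationCk (Minkowski.backgroundOn U₀) Ψ₀ 0 τ ≤ ENNReal.ofReal (1 / 8) ∧ ∀ i, 𝒟.toSpacetime.truncDeviationCk (boostedKerrBackground (mo i).1 (mo i).2 (M i) (a i)) (Ψ i) 0 (R i τ) τ ≤ ENNReal.ofReal (1 / 8)) ∧ (∃ B : NNReal, ∀ τ : ℝ, τ₀ < τ → 𝒟.toSpacetime.deviationCk (Minkowski.backgroundOn U₀) Ψ₀ (k + 4) τ ≤ (B : ENNReal)) ∧ (∀ R' : ℝ, ∃ B : NNReal, ∀ τ : ℝ, τ₀ < τ → ∀ i, 𝒟.toSpacetime.truncDeviationCk (boostedKerrBackground (mo i).1 (mo i).2 (M i) (a i)) (Ψ i) (k + 4) R' τ ≤ (B : ENNReal)) ∧ (∀ ε : ℝ, 0 < ε → ∃ Rf : ℝ, ∀ τ : ℝ, τ₀ < τ → supCkENorm (Subtype.val '' {x | x ∈ (Minkowski.backgroundOn U₀).timeSlab τ ∧ Rf ≤ ‖E4.spatial (x : E4)‖}) (k + 4) (𝒟.toSpacetime.deviationExtend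 (Minkowski.backgroundOn U₀) Ψ₀) ≤ ENNReal.ofReal ε) → (∀ i (R' : ℝ), Tendsto (fun τ ↦ supCkENorm (Subtype.val '' (boostedKerrBackground (mo i).1 (mo i).2 (M i) (a i)).truncTimeSlab R' τ) (k + 2) (fun y ↦ fderiv ℝ (𝒟.toSpacetime.deviationExtend (boostedKerrBackground (mo i).1 (mo i).2 (M i) (a i)) (Ψ i)) y (((mo i).1 : E4 ≃L[ℝ] E4) (E4.basisVector 0)))) atTop (𝓝 0)) ∧ Tendsto (fun τ ↦ supCkENorm (Subtype.val '' (Minkowski.backgroundOn U₀).timeSlab τ) (k + 2) (fun y ↦ fderiv ℝ (𝒟.toSpacetime.deviationExtend (Minkowski.backgroundOn U₀) Ψ₀) y (E4.basisVector 0))) atTop (𝓝 0)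

/-- Signature of `stub_noHairUpToGauge` (see the stub's docstring). -/
def Sig.stub_noHairUpToGauge : Prop :=
  ∀ k : ℕ, ∀ (Λ : lorentzGroup) (c : E4) (M a : ℝ), 0 < M → |a| ≤ M → ∀ (G : E4 → E4 →L[ℝ] E4 →L[ℝ] ℝ), ContDiffOn ℝ (k + 3) G (boostedKerrExterior Λ c M a : Set E4) → (∀ x ∈ (boostedKerrExterior Λ c M a : Set E4), (G x).IsInvertible ∧ (∀ v w : E4, G x v w = G x w v) ∧ ∃ v : E4, G x v v < 0 ∧ ∀ w : E4, G x v w = 0 → w ≠ 0 → 0 < G x w w) → (∀ x ∈ (boostedKerrExterior Λ c M a : Set E4), MetricCoord.ricAt G x = 0) → (∀ x ∈ (boostedKerrExterior Λ c M a : Set E4), ‖G x - boostedKerrBilin Λ c M a x‖ ≤ 1 / 4) → (∀ R' : ℝ, ∃ C : ℝ, ∀ x ∈ (boostedKerrExterior Λ c M a : Set E4), Kerr.radius a (poincareInv Λ c x) ≤ R' → ∀ j : ℕ, j ≤ k + 3 → ‖iteratedFDeriv ℝ j G x‖ ≤ C) → (∀ x ∈ (boostedKerrExterior Λ c M a : Set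 E4), ∀ s : ℝ, G (x + s • ((Λ : E4 ≃L[ℝ] E4) (E4.basisVector 0))) = G x) → (∀ ε : ℝ, 0 < ε → ∃ δ : ℝ, 0 < δ ∧ ∀ x ∈ (boostedKerrExterior Λ c M a : Set E4), Kerr.radius a (poincareInv Λ c x) < Kerr.rPlus M a + δ → |((fderiv ℝ (fun y ↦ Kerr.radius a (poincareInv Λ c y)) x) (MetricCoord.sharpAt G x (fderiv ℝ (fun y ↦ Kerr.radius a (poincareInv Λ c y)) x)))| ≤ ε) → ∃ (M' a' : ℝ) (Λ' : lorentzGroup) (c' : E4) (θ : E4 → E4), 0 < M' ∧ |a'| ≤ M' ∧ (Λ' : E4 ≃L[ℝ] E4) (E4.basisVector 0) = ((Λ : E4 ≃L[ℝ] E4) (E4.basisVector 0)) ∧ ContDiffOn ℝ (k + 3) θ (boostedKerrExterior Λ' c' M' a' : Set E4) ∧ Set.InjOn θ (boostedKerrExterior Λ' c' M' a' : Set E4) ∧ θ '' (boostedKerrExterior Λ' c' M' a' : Set E4) = (boostedKerrExterior Λ c M a : Set E4) ∧ (∀ x ∈ (boostedKerrExterior Λ' c' M' a' : Set E4), ∀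 s : ℝ, θ (x + s • ((Λ : E4 ≃L[ℝ] E4) (E4.basisVector 0))) = θ x + s • ((Λ : E4 ≃L[ℝ] E4) (E4.basisVector 0))) ∧ ∀ x ∈ (boostedKerrExterior Λ' c' M' a' : Set E4), ∀ v w : E4, G (θ x) (fderiv ℝ θ x v) (fderiv ℝ θ x w) = boostedKerrBilin Λ' c' M' a' x v w

/-- Signature of `stub_rebase` (see the stub's docstring). -/
def Sig.stub_rebase : Prop :=
  ∀ (k : ℕ) (X : Type) [TopologicalSpace X] [ChartedSpace E3 X] [IsManifold (𝓡 3) ∞ X] [T2Space X] [SecondCountableTopology X] [ConnectedSpace X], ∀ D ∈ admissibleVacuumData X, ∀ 𝒟 : VacuumCauchyDevelopment D, 𝒟.IsMaximal → ¬ (Summit.FinalStateConjecture.HasCompleteNullInfinity 𝒟.toCauchyDevelopment ∧ ∃ (O : Set 𝒟.carrier) (d : FinalStateDecomposition 𝒟.toSpacetime O 2), (∀ i, Kerr.IsSubextremal (d.mass i) (d.spin i)) ∧ O = Summit.FinalStateConjecture.exteriorOf 𝒟.toCauchyDevelopment d.charted ∧ Summit.FinalStateConjecture.RaysStayInClosure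 𝒟.toCauchyDevelopment O ∧ Summit.FinalStateConjecture.HasExhaustiveCharts d ∧ Summit.FinalStateConjecture.IsFutureOriented d) → (∀ (Λ : lorentzGroup) (c : E4) (M a : ℝ), 0 < M → |a| ≤ M → ∀ (G : E4 → E4 →L[ℝ] E4 →L[ℝ] ℝ), ContDiffOn ℝ (k + 3) G (boostedKerrExterior Λ c M a : Set E4) → (∀ x ∈ (boostedKerrExterior Λ c M a : Set E4), (G x).IsInvertible ∧ (∀ v w : E4, G x v w = G x w v) ∧ ∃ v : E4, G x v v < 0 ∧ ∀ w : E4, G x v w = 0 → w ≠ 0 → 0 < G x w w) → (∀ x ∈ (boostedKerrExterior Λ c M a : Set E4), MetricCoord.ricAt G x = 0) → (∀ x ∈ (boostedKerrExterior Λ c M a : Set E4), ‖G x - boostedKerrBilin Λ c M a x‖ ≤ 1 / 4) → (∀ R' : ℝ, ∃ C : ℝ, ∀ x ∈ (boostedKerrExterior Λ c M a : Set E4), Kerr.radius a (poincareInv Λ c x) ≤ R' → ∀ j : ℕ, j ≤ k + 3 → ‖iteratedFDeriv ℝ j G x‖ ≤ C) → (∀ x ∈ (boostedKerrExterior Λ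 c M a : Set E4), ∀ s : ℝ, G (x + s • ((Λ : E4 ≃L[ℝ] E4) (E4.basisVector 0))) = G x) → (∀ ε : ℝ, 0 < ε → ∃ δ : ℝ, 0 < δ ∧ ∀ x ∈ (boostedKerrExterior Λ c M a : Set E4), Kerr.radius a (poincareInv Λ c x) < Kerr.rPlus M a + δ → |((fderiv ℝ (fun y ↦ Kerr.radius a (poincareInv Λ c y)) x) (MetricCoord.sharpAt G x (fderiv ℝ (fun y ↦ Kerr.radius a (poincareInv Λ c y)) x)))| ≤ ε) → ∃ (M' a' : ℝ) (Λ' : lorentzGroup) (c' : E4) (θ : E4 → E4), 0 < M' ∧ |a'| ≤ M' ∧ (Λ' : E4 ≃L[ℝ] E4) (E4.basisVector 0) = ((Λ : E4 ≃L[ℝ] E4) (E4.basisVector 0)) ∧ ContDiffOn ℝ (k + 3) θ (boostedKerrExterior Λ' c' M' a' : Set E4) ∧ Set.InjOn θ (boostedKerrExterior Λ' c' M' a' : Set E4) ∧ θ '' (boostedKerrExterior Λ' c' M' a' : Set E4) = (boostedKerrExterior Λ c M a : Set E4) ∧ (∀ x ∈ (boostedKerrExterior Λ' c' M' a' : Set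 E4), ∀ s : ℝ, θ (x + s • ((Λ : E4 ≃L[ℝ] E4) (E4.basisVector 0))) = θ x + s • ((Λ : E4 ≃L[ℝ] E4) (E4.basisVector 0))) ∧ ∀ x ∈ (boostedKerrExterior Λ' c' M' a' : Set E4), ∀ v w : E4, G (θ x) (fderiv ℝ θ x v) (fderiv ℝ θ x w) = boostedKerrBilin Λ' c' M' a' x v w) → ∀ (O : Set 𝒟.carrier) (N : ℕ) (M a : Fin N → ℝ) (mo : Fin N → lorentzGroup × E4) (τ₀ : ℝ) (Ψ : ∀ i, boostedKerrExterior (mo i).1 (mo i).2 (M i) (a i) → 𝒟.carrier) (ρ R : Fin N → ℝ → ℝ) (U₀ : Opens E4) (Ψ₀ : U₀ → 𝒟.carrier), (∀ i, 0 < M i ∧ |a i| ≤ M i) ∧ (∀ i, 𝒟.toSpacetime.IsLateChart (boostedKerrBackground (mo i).1 (mo i).2 (M i) (a i)) O τ₀ (Ψ i)) ∧ 𝒟.toSpacetime.IsLateChart (Minkowski.backgroundOn U₀) O τ₀ Ψ₀ ∧ (∀ i, Tendsto (fun t ↦ ρ i t / t) atTop (𝓝 0)) ∧ (∀ i, Tendsto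 (R i) atTop atTop ∧ ∀ τ, max (Kerr.rPlus (M i) (a i)) 0 + 1 ≤ R i τ) ∧ {x : E4 | τ₀ < x 0 ∧ ∀ i, ρ i (x 0) < Kerr.radius (a i) (poincareInv (mo i).1 (mo i).2 x)} ⊆ (U₀ : Set E4) ∧ (∀ R' : ℝ, ∃ τ₁ : ℝ, Pairwise (Function.onFun Disjoint fun i ↦ Ψ i '' (boostedKerrBackground (mo i).1 (mo i).2 (M i) (a i)).truncLateRegion τ₁ R')) ∧ O = Summit.FinalStateConjecture.exteriorOf 𝒟.toCauchyDevelopment ((⋃ i, Ψ i '' (boostedKerrBackground (mo i).1 (mo i).2 (M i) (a i)).lateRegion τ₀) ∪ Ψ₀ '' (Minkowski.backgroundOn U₀).lateRegion τ₀) ∧ Summit.FinalStateConjecture.RaysStayInClosure 𝒟.toCauchyDevelopment O ∧ (∀ τ₁ : ℝ, τ₀ < τ₁ → O \ (Ψ₀ '' (Minkowski.backgroundOn U₀).lateRegion τ₁ ∪ ⋃ i, Ψ i '' {x | τ₁ < (boostedKerrBackground (mo i).1 (mo i).2 (M i) (a i)).time x.1 ∧ (boostedKerrBackground (mo i).1 (mo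 i).2 (M i) (a i)).radius x.1 ≤ R i ((boostedKerrBackground (mo i).1 (mo i).2 (M i) (a i)).time x.1)}) ⊆ 𝒟.metric.causalPast 𝒟.timeOrientation (Ψ₀ '' (Minkowski.backgroundOn U₀).timeSlab τ₁ ∪ ⋃ i, Ψ i '' (boostedKerrBackground (mo i).1 (mo i).2 (M i) (a i)).truncTimeSlab (R i τ₁) τ₁)) ∧ ((∀ i, Summit.FinalStateConjecture.IsOrthochronous (mo i).1) ∧ ∀ τ : ℝ, τ₀ < τ → ∀ x ∈ (Minkowski.backgroundOn U₀).timeSlab τ, 𝒟.toSpacetime.timeOrientation.IsFutureDirected (mfderiv 𝓘(ℝ, E4) (𝓡 4) Ψ₀ x (E4.basisVector 0))) ∧ (∀ τ : ℝ, τ₀ < τ → 𝒟.toSpacetime.deviationCk (Minkowski.backgroundOn U₀) Ψ₀ 0 τ ≤ ENNReal.ofReal (1 / 8) ∧ ∀ i, 𝒟.toSpacetime.truncDeviationCk (boostedKerrBackground (mo i).1 (mo i).2 (M i) (a i)) (Ψ i) 0 (R i τ) τ ≤ ENNReal.ofReal (1 / 8)) ∧ (∃ B : NNReal, ∀ τ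 : ℝ, τ₀ < τ → 𝒟.toSpacetime.deviationCk (Minkowski.backgroundOn U₀) Ψ₀ (k + 4) τ ≤ (B : ENNReal)) ∧ (∀ R' : ℝ, ∃ B : NNReal, ∀ τ : ℝ, τ₀ < τ → ∀ i, 𝒟.toSpacetime.truncDeviationCk (boostedKerrBackground (mo i).1 (mo i).2 (M i) (a i)) (Ψ i) (k + 4) R' τ ≤ (B : ENNReal)) ∧ (∀ ε : ℝ, 0 < ε → ∃ Rf : ℝ, ∀ τ : ℝ, τ₀ < τ → supCkENorm (Subtype.val '' {x | x ∈ (Minkowski.backgroundOn U₀).timeSlab τ ∧ Rf ≤ ‖E4.spatial (x : E4)‖}) (k + 4) (𝒟.toSpacetime.deviationExtend (Minkowski.backgroundOn U₀) Ψ₀) ≤ ENNReal.ofReal ε) → (∀ i, (∀ ε : ℝ, 0 < ε → ∃ δ : ℝ, 0 < δ ∧ ∀ τ : ℝ, τ₀ < τ → ∀ x ∈ (boostedKerrBackground (mo i).1 (mo i).2 (M i) (a i)).truncTimeSlab (Kerr.rPlus (M i) (a i) + δ) τ, |((fderiv ℝ (fun y ↦ Kerr.radius (a i) (poincareInv (mo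 i).1 (mo i).2 y)) (x : E4)) (MetricCoord.sharpAt (fun y ↦ (𝒟.toSpacetime.deviationExtend (boostedKerrBackground (mo i).1 (mo i).2 (M i) (a i)) (Ψ i)) y + boostedKerrBilin (mo i).1 (mo i).2 (M i) (a i) y) (x : E4) (fderiv ℝ (fun y ↦ Kerr.radius (a i) (poincareInv (mo i).1 (mo i).2 y)) (x : E4))))| ≤ ε)) → (∀ i (R' : ℝ), Tendsto (fun τ ↦ supCkENorm (Subtype.val '' (boostedKerrBackground (mo i).1 (mo i).2 (M i) (a i)).truncTimeSlab R' τ) (k + 2) (fun y ↦ fderiv ℝ (𝒟.toSpacetime.deviationExtend (boostedKerrBackground (mo i).1 (mo i).2 (M i) (a i)) (Ψ i)) y (((mo i).1 : E4 ≃L[ℝ] E4) (E4.basisVector 0)))) atTop (𝓝 0)) ∧ Tendsto (fun τ ↦ supCkENorm (Subtype.val '' (Minkowski.backgroundOn U₀).timeSlab τ) (k + 2) (fun y ↦ fderiv ℝ (𝒟.toSpacetime.deviationExtend (Minkowski.backgroundOn U₀) Ψ₀) y (E4.basisVector 0))) atTop (𝓝 0) → ∃ (O : Set 𝒟.carrier)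 (N : ℕ) (M a : Fin N → ℝ) (mo : Fin N → lorentzGroup × E4) (τ₀ : ℝ) (Ψ : ∀ i, boostedKerrExterior (mo i).1 (mo i).2 (M i) (a i) → 𝒟.carrier) (ρ R : Fin N → ℝ → ℝ) (U₀ : Opens E4) (Ψ₀ : U₀ → 𝒟.carrier), (∀ i, 0 < M i ∧ |a i| ≤ M i) ∧ (∀ i, 𝒟.toSpacetime.IsLateChart (boostedKerrBackground (mo i).1 (mo i).2 (M i) (a i)) O τ₀ (Ψ i)) ∧ 𝒟.toSpacetime.IsLateChart (Minkowski.backgroundOn U₀) O τ₀ Ψ₀ ∧ (∀ i, Tendsto (fun t ↦ ρ i t / t) atTop (𝓝 0)) ∧ (∀ i, Tendsto (R i) atTop atTop ∧ ∀ τ, max (Kerr.rPlus (M i) (a i)) 0 + 1 ≤ R i τ) ∧ {x : E4 | τ₀ < x 0 ∧ ∀ i, ρ i (x 0) < Kerr.radius (a i) (poincareInv (mo i).1 (mo i).2 x)} ⊆ (U₀ : Set E4) ∧ (∀ R' : ℝ, ∃ τ₁ : ℝ, Pairwise (Function.onFun Disjoint fun i ↦ Ψ i '' (boostedKerrBackground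 (mo i).1 (mo i).2 (M i) (a i)).truncLateRegion τ₁ R')) ∧ O = Summit.FinalStateConjecture.exteriorOf 𝒟.toCauchyDevelopment ((⋃ i, Ψ i '' (boostedKerrBackground (mo i).1 (mo i).2 (M i) (a i)).lateRegion τ₀) ∪ Ψ₀ '' (Minkowski.backgroundOn U₀).lateRegion τ₀) ∧ Summit.FinalStateConjecture.RaysStayInClosure 𝒟.toCauchyDevelopment O ∧ (∀ τ₁ : ℝ, τ₀ < τ₁ → O \ (Ψ₀ '' (Minkowski.backgroundOn U₀).lateRegion τ₁ ∪ ⋃ i, Ψ i '' {x | τ₁ < (boostedKerrBackground (mo i).1 (mo i).2 (M i) (a i)).time x.1 ∧ (boostedKerrBackground (mo i).1 (mo i).2 (M i) (a i)).radius x.1 ≤ R i ((boostedKerrBackground (mo i).1 (mo i).2 (M i) (a i)).time x.1)}) ⊆ 𝒟.metric.causalPast 𝒟.timeOrientation (Ψ₀ '' (Minkowski.backgroundOn U₀).timeSlab τ₁ ∪ ⋃ i, Ψ i '' (boostedKerrBackground (mo i).1 (mo i).2 (M i) (a i)).truncTimeSlab (R i τ₁) τ₁)) ∧ ((∀ i,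 Summit.FinalStateConjecture.IsOrthochronous (mo i).1) ∧ ∀ τ : ℝ, τ₀ < τ → ∀ x ∈ (Minkowski.backgroundOn U₀).timeSlab τ, 𝒟.toSpacetime.timeOrientation.IsFutureDirected (mfderiv 𝓘(ℝ, E4) (𝓡 4) Ψ₀ x (E4.basisVector 0))) ∧ (∀ τ : ℝ, τ₀ < τ → 𝒟.toSpacetime.deviationCk (Minkowski.backgroundOn U₀) Ψ₀ 0 τ ≤ ENNReal.ofReal (1 / 4) ∧ ∀ i, 𝒟.toSpacetime.truncDeviationCk (boostedKerrBackground (mo i).1 (mo i).2 (M i) (a i)) (Ψ i) 0 (R i τ) τ ≤ ENNReal.ofReal (1 / 4)) ∧ ∀ R' : ℝ, ∀ ε : ℝ, 0 < ε → ∃ᶠ τ in atTop, 𝒟.toSpacetime.deviationCk (Minkowski.backgroundOn U₀) Ψ₀ (k + 2) τ ≤ ENNReal.ofReal ε ∧ ∀ i, 𝒟.toSpacetime.truncDeviationCk (boostedKerrBackground (mo i).1 (mo i).2 (M i) (a i)) (Ψ i) (k + 2) R' τ ≤ ENNReal.ofReal ε ∧ ∀ x ∈ (boostedKerrBackground (mo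 i).1 (mo i).2 (M i) (a i)).truncTimeSlab R' τ, 𝒟.toSpacetime.timeOrientation.IsFutureDirected (mfderiv 𝓘(ℝ, E4) (𝓡 4) (Ψ i) x (((mo i).1 : E4 ≃L[ℝ] E4) (Kerr.timeVector (M i) (a i) (poincareInv (mo i).1 (mo i).2 (x : E4)))))

/-! ### The registered stubs (the ONLY sorries of this file) -/

/-- **STUB 1 `stub_eraHorizonNull` (geometric, L).** In every tame era of a maximal development of
admissible data, the inner boundary `{rᵢ = r₊(Mᵢ, aᵢ)}` of each hole chart is the event horizon and is
NULL for the chart metric `hᵢ = Ψᵢ^* g` (extended by the era's bounds): the red-shift scalar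
`hᵢ⁻¹(drᵢ, drᵢ)` tends to `0` uniformly at the inner boundary, at all late times. Mechanism: exhaustion
(C10) at every chart time forces the charts to cover all late points of `O`, separation (C7) and the flat
anchor exclude any other chart from a horizon collar, so `Ψᵢ` extends as an isometric immersion of the
closed tube with boundary onto `H⁺ ∩ {late}`, an achronal hence null `C¹` hypersurface whose conormal is
`drᵢ`. [folklore] -/
theorem stub_eraHorizonNull : Sig.stub_eraHorizonNull := by
  sorry

/-- **STUB 2 `stub_asymptoticallyStationaryEra` (dynamics; research-grade, XL).** A tame era of a
NON-SETTLING maximal development of admissible data is ASYMPTOTICALLY STATIONARY in era gauge: the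
`C^{k+2}` size of the Killing-translation derivative `∂_{Λᵢ∂₀}(Ψᵢ^* g − g_{Mᵢ,aᵢ,Λᵢ,cᵢ})` on every
truncated slab, and of `∂₀(Ψ₀^* g − η)` on the flat slabs, tends to `0`. Mechanism of record (line leads
gens 5–6, all plumbing landed `--supports` the parent crux): a TRANSFER INEQUALITY paying the window
Killing-defect flux by Bondi-mass decrements (`…KillingDefectTransfer`), or Birkhoff uniform recurrence of
dark limits + ALMOST-PERIODIC RIGIDITY (`…UniformRecurrence`, `ReLineBirkhoff.AlmostPeriodicRigidity`);
Barbalat / Fatou forms landed (`…FluxFatou`, `…ScriBudget`). Nearest print: Alexakis–Schlue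
arXiv:1504.04592 (time-periodic ⇒ stationary near 𝓘⁺), Bičák–Scholtz–Tod arXiv:1003.3402. [cite: AlexakisSchlue2018] -/
theorem stub_asymptoticallyStationaryEra : Sig.stub_asymptoticallyStationaryEra := by
  sorry

/-- **STUB 3 `stub_noHairUpToGauge` (rigidity; research-grade, XL — black-hole uniqueness without
analyticity or smallness, UP TO GAUGE).** A `C^{k+3}` Lorentzian, Ricci-flat chart metric `G` on a
closed-label boosted Kerr exterior tube `{r > r₊(M,a)} × ℝ`, `1/4`-anchored to `g_{M,a,Λ,c}`, tame on
every `{r ≤ R'}`, invariant under the Killing translation `Λ∂₀`, and for which the inner boundary is a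
null horizon (`G⁻¹(dr,dr) → 0`), is ISOMETRIC to a boosted Kerr–Schild exterior `g_{M',a',Λ',c'}` with a
closed label `|a'| ≤ M'` and the SAME asymptotic 4-velocity `Λ'∂₀ = Λ∂₀`, through a gauge `θ` commuting
with the translations and mapping the new exterior ONTO the tube. Known only for `G` `C²`-close to Kerr
(Alexakis–Ionescu–Klainerman 2010) or real-analytic (Carter–Robinson, Hawking, Chruściel–Costa);
asymptotic flatness of stationary ends from boundedness: Reiris arXiv:1002.1172. [cite: arXiv:1002.1172] -/
theorem stub_noHairUpToGauge : Sig.stub_noHairUpToGauge := by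
  sorry

/-- **STUB 4 `stub_rebase` (compactness + select-and-rebase + boundary layers; L).** Granted no-hair up to
gauge (stub 3 as a hypothesis): a tame era of a non-settling maximal development of admissible data whose
hole charts have null inner boundaries (stub 1) and which is asymptotically stationary (stub 2) RECURS at
order `k + 2` with closed labels. Mechanism (landed toolkit of the parent crux, gens 3–6): `C^{k+3}_loc`
dark limits of the hole deviations exist jointly along some `Tₙ → ∞` (`…JointOmegaLimits`), inherit the
anchor, the bounds and the vacuum equations (`…OmegaLimitGlue/LimitBounds/VacuumOmegaLimits/LimitIsMetric`),
are stationary by asymptotic stationarity (`…AsymptoticStationarity`, converse direction), hence Kerr up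
to gauge `θᵢ` with labels within the anchor slack; re-base the hole charts by `Ψᵢ ∘ θᵢ` (anchor
`1/8 + 1/8 ≤ 1/4`, `…LabelRebase/MotionRebase`), re-chart the far zone against the stationary far field
(quarantine + flat anchor), transfer C2–C11 to the re-based system (same `O`), read recurrence at every
radius from `dark limit = reference` (`…ZeroLimitsConverge`, `…BackgroundOmegaLimits`) and close the
horizon boundary layer with the all-time `C^{k+3}` bounds along outward cones (`Birth.stub_holeCone` of
the parent line); orientation of `Λᵢ'V` at the recurrence instants from C11 + exhaustion. [folklore] -/
theorem stub_rebase : Sig.stub_rebase := by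
  sorry

/-! ### Composition: the four stubs give the piece -/

/-- **Child 2 from its stubs.** Pure logic: unpack the era, feed the horizon-null certificate (stub 1)
and asymptotic stationarity (stub 2) together with the no-hair hypothesis (stub 3) to the rebase stub (4). -/
theorem TameEraRecurs_of (hh : Sig.stub_eraHorizonNull) (h₁ : Sig.stub_asymptoticallyStationaryEra)
    (h₀ : Sig.stub_noHairUpToGauge) (h₂ : Sig.stub_rebase) : Sig.TameEraRecurs := by
  intro k X _ _ _ _ _ _ D hD 𝒟 hmax hT hS
  obtain ⟨O, N, M, a, mo, τ₀, Ψ, ρ, R, U₀, Ψ₀, hera⟩ := hT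
  exact h₂ k X D hD 𝒟 hmax hS (h₀ k) O N M a mo τ₀ Ψ ρ R U₀ Ψ₀ hera
    (hh k X D hD 𝒟 hmax O N M a mo τ₀ Ψ ρ R U₀ Ψ₀ hera) (h₁ k X D hD 𝒟 hmax hS O N M a mo τ₀ Ψ ρ R U₀ Ψ₀ hera)

/-- … with the registered stubs plugged in. -/
theorem TameEraRecurs_of_stubs : Sig.TameEraRecurs :=
  TameEraRecurs_of stub_eraHorizonNull stub_asymptoticallyStationaryEra stub_noHairUpToGauge stub_rebase

end Summit.FinalStateConjecture.FinalStateConjecture.Cruxes.TameEraRecurs.Birth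

end
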